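import Literature.Probability.RandomPlanarGeometry.WholePlaneClosedDiscPiece
import Literature.Analysis.Complex.InjectiveHolomorphic
import Literature.Analysis.Complex.RiemannMapping
import HarnessLib

/-!
# Concatenating radial pieces: generation of the increments over every horizon

Topic `Probability/RandomPlanarGeometry`; one `Prop`-valued structure (`SDGenerated`, the
generation data of the radial chain of the shifted driver) and proved theorems (no named fact).
Sequel of `WholePlaneClosedDiscPiece`. The radial theory of a random driving function
(`RadialSLE.ae_locallyGenerated`, Schramm–Wilson pull-back of Rohde–Schramm) describes the chain of
the increment driver from a base time `b` only up to a finite horizon (the swallowing time of the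
antipodal marked point); the deterministic assembly `isCurve_tip_of_locallyGenerated` needs it over
EVERY horizon. This file closes the gap deterministically: pieces from consecutive base times are
concatenated inside the disc.

In the shifted-driver picture (`U_b = shiftDriver lam b`, driving point `e^{-iλ(b+·)}`) the charts
from the bases `b` and `b + u` differ by the radial map itself, `Ψ_{b+u} = g^𝔻_u ∘ Ψ_b`
(`map_add_eq`), without any rotation; so, with `ψ = (g^𝔻_u)⁻¹ : 𝔻 → D_u` and its Carathéodory
extension `ψ̄` to `𝔻̄` (`ConformalEquiv.continuousOn_extendFrom_of_lc`; `ℂ ∖ D_u ⊇ ∂D_u` is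
contained in the uniformly locally connected continuum `η₁[0, u] ∪ ∂𝔻`):

* `SDGenerated lam b u₂ η` — `η` continuous, `|η| ≤ 1`, `η₀ = e^{-iλ_b}`, and for `v ≤ u₂` the
  domain `D_v(U_b)` is the component of `0` in `𝔻 ∖ η[0, v]` and `(g^𝔻_v)⁻¹(r e^{iU_b(v)}) → η_v`;
  `SDGenerated.of_locallyGenerated`, `locallyGenerated_of_sdGenerated` — the dictionary with
  `RadialSLE.LocallyGenerated (incr lam b)` (reflection-rotation `w ↦ e^{-iλ_b} w̄`);
* `domain_add_iff`, `map_add_add`, `domain_add_eq_image`, `invFunOn_map_add` — the **radial Markov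
  property in the disc** between the bases `b` and `b + u` (from the whole-plane one);
* `ConformalEquiv.image_connectedComponentIn_eq` — the filled-trace identity
  `ψ(D₀(𝔻 ∖ P₂)) = D₀(𝔻 ∖ (P₁ ∪ ψ̄ P₂))`;
* `SDGenerated.append` — **concatenation**: data from `b` up to `u` and from `b + u` up to `u'`
  give data from `b` up to `u + u'`, with the curve `η₁` on `[0, u]` followed by `ψ̄ ∘ η₂(· - u)`;
* `locallyGenerated_of_windows` — **from windows to every horizon**: if from every rational base
  the increments are locally generated up to horizons bounded below uniformly on compact sets of
  base times (`WholePlaneLoewnerChain.exists_pathHorizon_ge`), then from every rational base they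
  are locally generated up to every time.

## References

* J. Miller, S. Sheffield, *Imaginary geometry IV*, PTRF 169 (2017), arXiv:1302.4738, §2.1.3,
  Prop. 2.5 (proof), Prop. 2.2 (conformal Markov property). [MillerSheffield2013]
* G. F. Lawler, *Conformally Invariant Processes in the Plane*, AMS (2005), §4.2–4.3. [Lawler2005]
* Ch. Pommerenke, *Boundary Behaviour of Conformal Maps*, Springer (1992), Thm. 2.1.
  [PommerenkeBBCM1992]
-/

noncomputable section

open Set Filter Topology Metric Complex Function
open scoped NNReal ComplexConjugate
open Literature.Topology.PlaneTopology

namespace Literature.Probability.RandomPlanarGeometry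

namespace WholePlaneLoewnerChain

variable {lam : ℝ → ℝ}

/-! ### Generation data in the shifted-driver picture -/

/-- **Generation data of the radial chain of the shifted driver `U_b = -λ(b + ·)` up to `u₂`**: a
continuous curve `η` in the closed disc with `η₀ = e^{-iλ_b}` such that for `v ≤ u₂` the radial
domain is the component of `0` in `𝔻 ∖ η[0, v]` and the tips `(g^𝔻_v)⁻¹(r e^{iU_b(v)})` tend to
`η_v` as `r ↑ 1`. [cite: Lawler2005, §4.2] -/
structure SDGenerated (lam : ℝ → ℝ) (b : ℝ) (u₂ : ℝ≥0) (η : ℝ≥0 → ℂ) : Prop where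
  continuous : Continuous η
  zero : η 0 = Complex.exp (((-lam b : ℝ) : ℂ) * Complex.I)
  norm_le : ∀ s, ‖η s‖ ≤ 1
  domain_eq : ∀ v : ℝ≥0, v ≤ u₂ → RadialLoewner.Disc.domain (WholePlaneLoewner.shiftDriver lam b) v =
    connectedComponentIn (ball (0 : ℂ) 1 \ η '' Icc 0 v) 0
  tendsto : ∀ v : ℝ≥0, v ≤ u₂ → Tendsto (fun r : ℝ ↦
      invFunOn (RadialLoewner.Disc.map (WholePlaneLoewner.shiftDriver lam b) v)
        (RadialLoewner.Disc.domain (WholePlaneLoewner.shiftDriver lam b) v)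
        ((r : ℂ) * Complex.exp (((WholePlaneLoewner.shiftDriver lam b v : ℝ) : ℂ) * Complex.I)))
    (𝓝[<] 1) (𝓝 (η v))

/-- Restriction of generation data to a shorter horizon. [folklore] -/
theorem SDGenerated.mono {b : ℝ} {u₂ u₂' : ℝ≥0} {η : ℝ≥0 → ℂ} (h : SDGenerated lam b u₂ η)
    (hu : u₂' ≤ u₂) : SDGenerated lam b u₂' η :=
  ⟨h.continuous, h.zero, h.norm_le, fun v hv ↦ h.domain_eq v (hv.trans hu),
    fun v hv ↦ h.tendsto v (hv.trans hu)⟩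

/-- The approach points under reflection-rotation: `e^{ic} conj (r e^{iV}) = r e^{i(-V + c)}`.
[folklore] -/
theorem reflect_rotate_approach (c V r : ℝ) :
    Complex.exp ((c : ℂ) * Complex.I) * conj ((r : ℂ) * Complex.exp ((V : ℂ) * Complex.I)) =
      (r : ℂ) * Complex.exp (((-V + c : ℝ) : ℂ) * Complex.I) := by
  rw [map_mul, Complex.conj_ofReal, ← Complex.exp_conj, map_mul, Complex.conj_ofReal, Complex.conj_I,
    mul_left_comm, ← Complex.exp_add]
  congr 2
  push_cast
  ring

/-- **Transfer of generation data under the reflection-rotation `w ↦ e^{ic} w̄`** (driver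
`V ↦ -V + c`, curve `η ↦ e^{ic} η̄`): domains by `domain_eq_component_conj/rotate`, tips by
`invFunOn_map_reflect_rotate`. [cite: Lawler2005, §4.2] -/
theorem gen_reflect_rotate {V : ℝ≥0 → ℝ} (hV : Continuous V) (c : ℝ) {u₂ : ℝ≥0} {η : ℝ≥0 → ℂ}
    (hdom : ∀ v : ℝ≥0, v ≤ u₂ → RadialLoewner.Disc.domain V v =
      connectedComponentIn (ball (0 : ℂ) 1 \ η '' Icc 0 v) 0)
    (htip : ∀ v : ℝ≥0, v ≤ u₂ → Tendsto (fun r : ℝ ↦ invFunOn (RadialLoewner.Disc.map V v)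
      (RadialLoewner.Disc.domain V v) ((r : ℂ) * Complex.exp (((V v : ℝ) : ℂ) * Complex.I)))
      (𝓝[<] 1) (𝓝 (η v))) :
    (∀ v : ℝ≥0, v ≤ u₂ → RadialLoewner.Disc.domain (fun v ↦ -V v + c) v =
      connectedComponentIn (ball (0 : ℂ) 1 \
        (fun v ↦ Complex.exp ((c : ℂ) * Complex.I) * conj (η v)) '' Icc 0 v) 0) ∧
    ∀ v : ℝ≥0, v ≤ u₂ → Tendsto (fun r : ℝ ↦ invFunOn (RadialLoewner.Disc.map (fun v ↦ -V v + c) v)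
      (RadialLoewner.Disc.domain (fun v ↦ -V v + c) v)
      ((r : ℂ) * Complex.exp ((((fun v ↦ -V v + c) v : ℝ) : ℂ) * Complex.I)))
      (𝓝[<] 1) (𝓝 (Complex.exp ((c : ℂ) * Complex.I) * conj (η v))) := by
  refine ⟨fun v hv ↦ ?_, fun v hv ↦ ?_⟩
  · have h1 := RadialLoewner.Disc.domain_eq_component_conj (hdom v hv)
    have h2 := RadialLoewner.Disc.domain_eq_component_rotate h1 c
    rw [show (fun v ↦ -V v + c) = fun v ↦ (fun v ↦ -V v) v + c from rfl, h2]
  · have h3 : Tendsto (fun r : ℝ ↦ Complex.exp ((c : ℂ) * Complex.I) *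
        conj (invFunOn (RadialLoewner.Disc.map V v) (RadialLoewner.Disc.domain V v)
          ((r : ℂ) * Complex.exp (((V v : ℝ) : ℂ) * Complex.I)))) (𝓝[<] 1)
        (𝓝 (Complex.exp ((c : ℂ) * Complex.I) * conj (η v))) :=
      ((continuous_const.mul Complex.continuous_conj).tendsto _).comp (htip v hv)
    refine h3.congr' ?_
    filter_upwards [Ioo_mem_nhdsLT (show (0 : ℝ) < 1 by norm_num)] with r hr
    have hy : (r : ℂ) * Complex.exp (((V v : ℝ) : ℂ) * Complex.I) ∈ ball (0 : ℂ) 1 := by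
      rw [mem_ball_zero_iff, norm_mul, Complex.norm_exp_ofReal_mul_I, mul_one, Complex.norm_real,
        Real.norm_eq_abs, abs_of_pos hr.1]
      exact hr.2
    rw [← RadialLoewner.Disc.invFunOn_map_reflect_rotate hV c v hy, reflect_rotate_approach]

/-- The increment driver in terms of the shifted driver: `V_b = -U_b - λ_b`. [folklore] -/
theorem incr_eq_shiftDriver (lam : ℝ → ℝ) (b : ℝ) :
    incr lam b = fun v ↦ -WholePlaneLoewner.shiftDriver lam b v + -lam b := by
  funext v; simp only [incr, WholePlaneLoewner.shiftDriver_apply]; ring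

/-- **From `LocallyGenerated (incr lam b)` to shifted-driver generation data** (reflection-rotation
by `e^{-iλ_b}`). [cite: Lawler2005, §4.2] -/
theorem SDGenerated.of_locallyGenerated (hlam : Continuous lam) {b : ℝ} {u₁ : ℝ} {u₂ : ℝ≥0}
    (h : RadialSLE.LocallyGenerated (incr lam b) u₁) (hu : (u₂ : ℝ) < u₁) :
    ∃ η : ℝ≥0 → ℂ, SDGenerated lam b u₂ η := by
  obtain ⟨η₀, hc, h0, hle, hη⟩ := h u₂ hu
  have hV : Continuous (incr lam b) :=
    (hlam.comp (continuous_const.add NNReal.continuous_coe)).sub continuous_const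
  obtain ⟨hdom, htip⟩ := gen_reflect_rotate hV (-lam b) (fun v hv ↦ (hη v hv).1) (fun v hv ↦ (hη v hv).2)
  refine ⟨fun v ↦ Complex.exp (((-lam b : ℝ) : ℂ) * Complex.I) * conj (η₀ v), ⟨?_, ?_, ?_, ?_, ?_⟩⟩
  · exact continuous_const.mul (Complex.continuous_conj.comp hc)
  · simp [h0]
  · intro s
    rw [norm_mul, Complex.norm_exp_ofReal_mul_I, one_mul, Complex.norm_conj]
    exact hle s
  · intro v hv
    rw [shiftDriver_eq_incr]
    exact hdom v hv
  · intro v hv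
    rw [shiftDriver_eq_incr]
    exact htip v hv

/-- **From shifted-driver generation data over every horizon to `LocallyGenerated (incr lam b)`
over every horizon** (the inverse reflection-rotation). [cite: Lawler2005, §4.2] -/
theorem locallyGenerated_of_sdGenerated (hlam : Continuous lam) {b : ℝ}
    (h : ∀ u₂ : ℝ≥0, ∃ η : ℝ≥0 → ℂ, SDGenerated lam b u₂ η) (u₁ : ℝ) :
    RadialSLE.LocallyGenerated (incr lam b) u₁ := by
  intro u₂ hu₂
  obtain ⟨η, hη⟩ := h u₂
  have hU : Continuous (WholePlaneLoewner.shiftDriver lam b) := WholePlaneLoewner.continuous_shiftDriver hlam b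
  obtain ⟨hdom, htip⟩ := gen_reflect_rotate hU (-lam b) hη.domain_eq hη.tendsto
  refine ⟨fun v ↦ Complex.exp (((-lam b : ℝ) : ℂ) * Complex.I) * conj (η v), ?_, ?_, ?_, fun v hv ↦ ⟨?_, ?_⟩⟩
  · exact continuous_const.mul (Complex.continuous_conj.comp hη.continuous)
  · show Complex.exp (((-lam b : ℝ) : ℂ) * Complex.I) * conj (η 0) = 1
    rw [hη.zero, ← Complex.exp_conj, map_mul, Complex.conj_ofReal, Complex.conj_I, ← Complex.exp_add]
    push_cast
    ring_nf
    exact Complex.exp_zero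
  · intro s
    rw [norm_mul, Complex.norm_exp_ofReal_mul_I, one_mul, Complex.norm_conj]
    exact hη.norm_le s
  · rw [incr_eq_shiftDriver]; exact hdom v hv
  · rw [incr_eq_shiftDriver]; exact htip v hv

/-! ### The radial Markov property in the disc between the bases `b` and `b + u` -/

section DiscMarkov

/-- Base-time bookkeeping: `b + (u + s) = (b + u) + s`. [folklore] -/
theorem hull_add_add (C : WholePlaneLoewnerChain lam) (b : ℝ) (u s : ℝ≥0) :
    C.hull (b + ((u + s : ℝ≥0) : ℝ)) = C.hull (b + u + s) := by
  rw [NNReal.coe_add, add_assoc]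

/-- **Membership in the later domain**: `w ∈ D_{u+s}(U_b)` iff `w ∈ D_u(U_b)` and
`g^𝔻_u(w) ∈ D_s(U_{b+u})`. [cite: MillerSheffield2013, §2.1.3] -/
theorem domain_add_iff (hlam : Continuous lam) (b : ℝ) (u s : ℝ≥0) (w : ℂ) :
    w ∈ RadialLoewner.Disc.domain (WholePlaneLoewner.shiftDriver lam b) (u + s) ↔
      w ∈ RadialLoewner.Disc.domain (WholePlaneLoewner.shiftDriver lam b) u ∧
        RadialLoewner.Disc.map (WholePlaneLoewner.shiftDriver lam b) u w ∈
          RadialLoewner.Disc.domain (WholePlaneLoewner.shiftDriver lam (b + u)) s := by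
  have hU := WholePlaneLoewner.continuous_shiftDriver hlam b
  obtain ⟨⟨C⟩, -⟩ := WholePlaneLoewnerChain.exists_unique_holds lam hlam
  by_cases hw0 : w = 0
  · subst hw0
    simp only [RadialLoewner.Disc.zero_mem_domain, RadialLoewner.Disc.map_zero hU, true_and]
  constructor
  · intro hw
    have hw1 : ‖w‖ < 1 := mem_ball_zero_iff.1 (RadialLoewner.Disc.domain_subset _ _ hw)
    obtain ⟨hzb, hzw⟩ := C.exists_invCoord_eq hlam (b := b) hw0 hw1
    set z := WholePlaneLoewner.BackwardFlow.invMap lam b w⁻¹ with hz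
    have hzus : z ∉ C.hull (b + u + s) := by
      rw [← C.hull_add_add b u s, ← mem_compl_iff, C.compl_hull_add_eq hlam b (u + s)]
      exact ⟨hzb, hzw.symm ▸ hw⟩
    have hzu : z ∉ C.hull (b + u) := fun h ↦ hzus (C.hull_mono (by simp) h)
    have h1 : (C.map b z)⁻¹ ∈ RadialLoewner.Disc.domain (WholePlaneLoewner.shiftDriver lam b) u :=
      ((Set.ext_iff.1 (C.compl_hull_add_eq hlam b u) z).1 hzu).2
    have h2 : (C.map (b + u) z)⁻¹ ∈ RadialLoewner.Disc.domain (WholePlaneLoewner.shiftDriver lam (b + u)) s :=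
      ((Set.ext_iff.1 (C.compl_hull_add_eq hlam (b + u) s) z).1 hzus).2
    rw [C.map_add_eq hlam hzu, inv_inv, hzw] at h2
    exact ⟨hzw ▸ h1, h2⟩
  · rintro ⟨hw, hgw⟩
    have hw1 : ‖w‖ < 1 := mem_ball_zero_iff.1 (RadialLoewner.Disc.domain_subset _ _ hw)
    obtain ⟨hzb, hzw⟩ := C.exists_invCoord_eq hlam (b := b) hw0 hw1
    set z := WholePlaneLoewner.BackwardFlow.invMap lam b w⁻¹ with hz
    have hzu : z ∉ C.hull (b + u) := by
      rw [← mem_compl_iff, C.compl_hull_add_eq hlam b u]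
      exact ⟨hzb, hzw.symm ▸ hw⟩
    have hzus : z ∉ C.hull (b + u + s) := by
      rw [← mem_compl_iff, C.compl_hull_add_eq hlam (b + u) s]
      refine ⟨hzu, ?_⟩
      rw [C.map_add_eq hlam hzu, inv_inv, hzw]
      exact hgw
    rw [← C.hull_add_add b u s] at hzus
    have := ((Set.ext_iff.1 (C.compl_hull_add_eq hlam b (u + s)) z).1 hzus).2
    rwa [hzw] at this

/-- **The cocycle of the radial maps**: `g^𝔻_{u+s}(U_b) = g^𝔻_s(U_{b+u}) ∘ g^𝔻_u(U_b)` on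
`D_{u+s}(U_b)`. [cite: MillerSheffield2013, §2.1.3] -/
theorem map_add_add (hlam : Continuous lam) (b : ℝ) (u s : ℝ≥0) {w : ℂ}
    (hw : w ∈ RadialLoewner.Disc.domain (WholePlaneLoewner.shiftDriver lam b) (u + s)) :
    RadialLoewner.Disc.map (WholePlaneLoewner.shiftDriver lam b) (u + s) w =
      RadialLoewner.Disc.map (WholePlaneLoewner.shiftDriver lam (b + u)) s
        (RadialLoewner.Disc.map (WholePlaneLoewner.shiftDriver lam b) u w) := by
  have hU := WholePlaneLoewner.continuous_shiftDriver hlam b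
  have hU' := WholePlaneLoewner.continuous_shiftDriver hlam (b + u)
  obtain ⟨⟨C⟩, -⟩ := WholePlaneLoewnerChain.exists_unique_holds lam hlam
  by_cases hw0 : w = 0
  · subst hw0
    rw [RadialLoewner.Disc.map_zero hU, RadialLoewner.Disc.map_zero hU, RadialLoewner.Disc.map_zero hU']
  have hw1 : ‖w‖ < 1 := mem_ball_zero_iff.1 (RadialLoewner.Disc.domain_subset _ _ hw)
  obtain ⟨hzb, hzw⟩ := C.exists_invCoord_eq hlam (b := b) hw0 hw1
  set z := WholePlaneLoewner.BackwardFlow.invMap lam b w⁻¹ with hz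
  have hzus : z ∉ C.hull (b + ((u + s : ℝ≥0) : ℝ)) := by
    rw [← mem_compl_iff, C.compl_hull_add_eq hlam b (u + s)]
    exact ⟨hzb, hzw.symm ▸ hw⟩
  have hzus' : z ∉ C.hull (b + u + s) := C.hull_add_add b u s ▸ hzus
  have hzu : z ∉ C.hull (b + u) := fun h ↦ hzus' (C.hull_mono (by simp) h)
  have h1 := C.map_add_eq hlam hzus
  have h2 := C.map_add_eq hlam hzus'
  have h3 := C.map_add_eq hlam hzu
  rw [hzw] at h1 h3
  have h12 : C.map (b + ((u + s : ℝ≥0) : ℝ)) z = C.map (b + u + s) z := by rw [NNReal.coe_add, add_assoc]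
  rw [h12, h2, h3, inv_inv] at h1
  exact inv_injective h1.symm

/-- **The later domain is the image of the other base's domain under the inverse radial map**:
`D_{u+s}(U_b) = (g^𝔻_u)⁻¹(D_s(U_{b+u}))`. [cite: MillerSheffield2013, §2.1.3] -/
theorem domain_add_eq_image (hlam : Continuous lam) (b : ℝ) (u s : ℝ≥0) :
    RadialLoewner.Disc.domain (WholePlaneLoewner.shiftDriver lam b) (u + s) =
      invFunOn (RadialLoewner.Disc.map (WholePlaneLoewner.shiftDriver lam b) u)
        (RadialLoewner.Disc.domain (WholePlaneLoewner.shiftDriver lam b) u) ''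
        RadialLoewner.Disc.domain (WholePlaneLoewner.shiftDriver lam (b + u)) s := by
  have hU := WholePlaneLoewner.continuous_shiftDriver hlam b
  have hbij := RadialLoewner.Disc.bijOn_map hU u
  ext w
  constructor
  · intro hw
    obtain ⟨hwu, hgw⟩ := (domain_add_iff hlam b u s w).1 hw
    refine ⟨_, hgw, ?_⟩
    exact hbij.injOn (invFunOn_mem ⟨w, hwu, rfl⟩) hwu (invFunOn_eq ⟨w, hwu, rfl⟩)
  · rintro ⟨y, hy, rfl⟩
    have hyball : y ∈ ball (0 : ℂ) 1 := RadialLoewner.Disc.domain_subset _ _ hy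
    have hex : ∃ a ∈ RadialLoewner.Disc.domain (WholePlaneLoewner.shiftDriver lam b) u,
        RadialLoewner.Disc.map (WholePlaneLoewner.shiftDriver lam b) u a = y := hbij.surjOn hyball
    refine (domain_add_iff hlam b u s _).2 ⟨invFunOn_mem hex, ?_⟩
    rw [invFunOn_eq hex]
    exact hy

/-- **The cocycle of the inverse radial maps** on the disc:
`(g^𝔻_{u+s}(U_b))⁻¹ = (g^𝔻_u(U_b))⁻¹ ∘ (g^𝔻_s(U_{b+u}))⁻¹`. [cite: MillerSheffield2013, §2.1.3] -/
theorem invFunOn_map_add (hlam : Continuous lam) (b : ℝ) (u s : ℝ≥0) {y : ℂ} (hy : y ∈ ball (0 : ℂ) 1) :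
    invFunOn (RadialLoewner.Disc.map (WholePlaneLoewner.shiftDriver lam b) (u + s))
        (RadialLoewner.Disc.domain (WholePlaneLoewner.shiftDriver lam b) (u + s)) y =
      invFunOn (RadialLoewner.Disc.map (WholePlaneLoewner.shiftDriver lam b) u)
        (RadialLoewner.Disc.domain (WholePlaneLoewner.shiftDriver lam b) u)
        (invFunOn (RadialLoewner.Disc.map (WholePlaneLoewner.shiftDriver lam (b + u)) s)
          (RadialLoewner.Disc.domain (WholePlaneLoewner.shiftDriver lam (b + u)) s) y) := by
  have hU := WholePlaneLoewner.continuous_shiftDriver hlam b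
  have hU' := WholePlaneLoewner.continuous_shiftDriver hlam (b + u)
  have hbij := RadialLoewner.Disc.bijOn_map hU u
  have hbij' := RadialLoewner.Disc.bijOn_map hU' s
  have hbij'' := RadialLoewner.Disc.bijOn_map hU (u + s)
  set p := invFunOn (RadialLoewner.Disc.map (WholePlaneLoewner.shiftDriver lam (b + u)) s)
    (RadialLoewner.Disc.domain (WholePlaneLoewner.shiftDriver lam (b + u)) s) y with hp
  have hexp : ∃ a ∈ RadialLoewner.Disc.domain (WholePlaneLoewner.shiftDriver lam (b + u)) s,
      RadialLoewner.Disc.map (WholePlaneLoewner.shiftDriver lam (b + u)) s a = y := hbij'.surjOn hy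
  have hp1 : p ∈ RadialLoewner.Disc.domain (WholePlaneLoewner.shiftDriver lam (b + u)) s := invFunOn_mem hexp
  have hp2 : RadialLoewner.Disc.map (WholePlaneLoewner.shiftDriver lam (b + u)) s p = y := invFunOn_eq hexp
  have hpball : p ∈ ball (0 : ℂ) 1 := RadialLoewner.Disc.domain_subset _ _ hp1
  set q := invFunOn (RadialLoewner.Disc.map (WholePlaneLoewner.shiftDriver lam b) u)
    (RadialLoewner.Disc.domain (WholePlaneLoewner.shiftDriver lam b) u) p with hq
  have hexq : ∃ a ∈ RadialLoewner.Disc.domain (WholePlaneLoewner.shiftDriver lam b) u,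
      RadialLoewner.Disc.map (WholePlaneLoewner.shiftDriver lam b) u a = p := hbij.surjOn hpball
  have hq1 : q ∈ RadialLoewner.Disc.domain (WholePlaneLoewner.shiftDriver lam b) u := invFunOn_mem hexq
  have hq2 : RadialLoewner.Disc.map (WholePlaneLoewner.shiftDriver lam b) u q = p := invFunOn_eq hexq
  have hq3 : q ∈ RadialLoewner.Disc.domain (WholePlaneLoewner.shiftDriver lam b) (u + s) :=
    (domain_add_iff hlam b u s q).2 ⟨hq1, hq2.symm ▸ hp1⟩
  have hq4 : RadialLoewner.Disc.map (WholePlaneLoewner.shiftDriver lam b) (u + s) q = y := by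
    rw [map_add_add hlam b u s hq3, hq2, hp2]
  have hexy : ∃ a ∈ RadialLoewner.Disc.domain (WholePlaneLoewner.shiftDriver lam b) (u + s),
      RadialLoewner.Disc.map (WholePlaneLoewner.shiftDriver lam b) (u + s) a = y := hbij''.surjOn hy
  exact hbij''.injOn (invFunOn_mem hexy) hq3 ((invFunOn_eq hexy).trans hq4.symm)

end DiscMarkov

/-! ### The inverse radial map as a conformal equivalence, and its Carathéodory extension -/

section InvEquiv

/-- **The inverse radial Loewner map `(g^𝔻_u)⁻¹ : 𝔻 → D_u` as a conformal equivalence** (inverse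
of the bijective holomorphic `g^𝔻_u : D_u → 𝔻`; holomorphic by the inverse function theorem,
`Complex.differentiableOn_invFunOn_image`, the derivative of an injective holomorphic map being
zero-free, `SCV.deriv_ne_zero_of_injOn`). [cite: Lawler2005, §4.2] -/
def discInvEquiv {U : ℝ≥0 → ℝ} (hU : Continuous U) (u : ℝ≥0) :
    ConformalEquiv (ball (0 : ℂ) 1) (RadialLoewner.Disc.domain U u) where
  toFun := invFunOn (RadialLoewner.Disc.map U u) (RadialLoewner.Disc.domain U u)
  invFun := RadialLoewner.Disc.map U u
  source := ball 0 1
  target := RadialLoewner.Disc.domain U u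
  map_source' := fun _ hy ↦ invFunOn_mem ((RadialLoewner.Disc.bijOn_map hU u).surjOn hy)
  map_target' := fun _ hw ↦ (RadialLoewner.Disc.bijOn_map hU u).mapsTo hw
  left_inv' := fun _ hy ↦ invFunOn_eq ((RadialLoewner.Disc.bijOn_map hU u).surjOn hy)
  right_inv' := fun w hw ↦ (RadialLoewner.Disc.bijOn_map hU u).injOn (invFunOn_mem ⟨w, hw, rfl⟩) hw
    (invFunOn_eq ⟨w, hw, rfl⟩)
  source_eq := rfl
  target_eq := rfl
  differentiableOn := by
    have hbij := RadialLoewner.Disc.bijOn_map hU u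
    have ho := RadialLoewner.Disc.isOpen_domain hU u
    have hd := RadialLoewner.Disc.differentiableOn_map hU u
    have h := Complex.differentiableOn_invFunOn_image ho hd hbij.injOn fun z hz ↦
      Literature.Analysis.Complex.SCV.deriv_ne_zero_of_injOn hd ho hbij.injOn hz
    rwa [hbij.image_eq] at h
  differentiableOn_symm := RadialLoewner.Disc.differentiableOn_map hU u

/-- The conformal equivalence is the inverse radial map. [folklore] -/
@[simp] theorem discInvEquiv_apply {U : ℝ≥0 → ℝ} (hU : Continuous U) (u : ℝ≥0) (y : ℂ) :
    discInvEquiv hU u y = invFunOn (RadialLoewner.Disc.map U u) (RadialLoewner.Disc.domain U u) y := rfl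

/-- Its inverse is the radial map. [folklore] -/
@[simp] theorem discInvEquiv_symm_apply {U : ℝ≥0 → ℝ} (hU : Continuous U) (u : ℝ≥0) (w : ℂ) :
    (discInvEquiv hU u).symm w = RadialLoewner.Disc.map U u w := rfl

/-- The unit circle as the image of `[0, 2π]` under `circleMap 0 1`. [folklore] -/
theorem sphere_eq_image_circleMap : sphere (0 : ℂ) 1 = circleMap 0 1 '' Icc 0 (2 * Real.pi) := by
  refine Subset.antisymm ?_ ?_
  · have h := (periodic_circleMap (0 : ℂ) 1).image_Ioc Real.two_pi_pos 0
    rw [zero_add, range_circleMap, abs_one] at h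
    rw [← h]
    exact image_mono Ioc_subset_Icc_self
  · rintro _ ⟨t, -, rfl⟩
    have := range_circleMap (0 : ℂ) 1
    rw [abs_one] at this
    exact this ▸ mem_range_self t

/-- **The unit circle is uniformly locally connected** (a continuous image of an interval).
[cite: PommerenkeBBCM1992, §2.2] -/
theorem isUniformlyLocallyConnected_sphere : IsUniformlyLocallyConnected (sphere (0 : ℂ) 1) :=
  (IsUniformlyLocallyConnected.of_image_Icc (continuous_circleMap 0 1).continuousOn).congr
    sphere_eq_image_circleMap.symm

/-- **The frontier of the filled-trace domain lies on the trace or on the circle.** [folklore] -/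
theorem frontier_connectedComponentIn_subset {P : Set ℂ} (hP : IsClosed P) :
    frontier (connectedComponentIn (ball (0 : ℂ) 1 \ P) 0) ⊆ P ∪ sphere (0 : ℂ) 1 := by
  set O : Set ℂ := ball (0 : ℂ) 1 \ P with hO
  set D := connectedComponentIn O 0 with hD
  have hOo : IsOpen O := isOpen_ball.sdiff hP
  have hDo : IsOpen D := hOo.connectedComponentIn
  intro x hx
  have hxcl : x ∈ closure D := frontier_subset_closure hx
  have hxD : x ∉ D := by
    have : x ∉ interior D := hx.2
    rwa [hDo.interior_eq] at this
  have hx1 : ‖x‖ ≤ 1 := by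
    have : closure D ⊆ closedBall (0 : ℂ) 1 := closure_minimal
      ((connectedComponentIn_subset _ _).trans (fun y hy ↦ ball_subset_closedBall hy.1)) isClosed_closedBall
    exact mem_closedBall_zero_iff.1 (this hxcl)
  rcases hx1.eq_or_lt with h1 | h1
  · exact Or.inr (mem_sphere_zero_iff_norm.2 h1)
  · by_contra hxP
    rw [mem_union, not_or] at hxP
    have hxO : x ∈ O := ⟨mem_ball_zero_iff.2 h1, hxP.1⟩
    have hUo : IsOpen (connectedComponentIn O x) := hOo.connectedComponentIn
    obtain ⟨y, hyU, hyD⟩ := mem_closure_iff.1 hxcl _ hUo (mem_connectedComponentIn hxO)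
    have h2 : connectedComponentIn O x = D := by
      rw [hD, connectedComponentIn_eq hyD, ← connectedComponentIn_eq hyU]
    exact hxD (h2 ▸ mem_connectedComponentIn hxO)

/-- **Carathéodory's hypothesis for the filled-trace domain**: nearby frontier points of
`D = D₀(𝔻 ∖ P)`, `P` a Peano continuum, lie in small continua of `ℂ ∖ D` (inside the uniformly
locally connected `P ∪ ∂𝔻`). [cite: PommerenkeBBCM1992, Thm. 2.1] -/
theorem hlc_connectedComponentIn {P : Set ℂ} (hPc : IsCompact P) (hP : IsUniformlyLocallyConnected P) :
    ∀ ε > 0, ∃ δ > 0, ∀ a ∈ frontier (connectedComponentIn (ball (0 : ℂ) 1 \ P) 0),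
      ∀ b ∈ frontier (connectedComponentIn (ball (0 : ℂ) 1 \ P) 0), dist a b < δ →
        ∃ σ ⊆ (connectedComponentIn (ball (0 : ℂ) 1 \ P) 0)ᶜ, IsCompact σ ∧ IsPreconnected σ ∧
          a ∈ σ ∧ b ∈ σ ∧ σ ⊆ closedBall a ε := by
  set D := connectedComponentIn (ball (0 : ℂ) 1 \ P) 0 with hD
  have hQ : IsUniformlyLocallyConnected (P ∪ sphere (0 : ℂ) 1) :=
    hP.union isUniformlyLocallyConnected_sphere hPc (isCompact_sphere 0 1)
  have hQD : P ∪ sphere (0 : ℂ) 1 ⊆ Dᶜ := by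
    rintro x (hx | hx) hxD
    · exact (connectedComponentIn_subset _ _ hxD).2 hx
    · have h1 := mem_ball_zero_iff.1 (connectedComponentIn_subset _ _ hxD).1
      rw [mem_sphere_zero_iff_norm.1 hx] at h1
      exact lt_irrefl _ h1
  have hfr := frontier_connectedComponentIn_subset hPc.isClosed (P := P)
  intro ε hε
  obtain ⟨δ, hδ, hσ⟩ := hQ ε hε
  refine ⟨δ, hδ, fun a ha b hb hab ↦ ?_⟩
  obtain ⟨σ, hσQ, hσK, hσc, haσ, hbσ, hσε⟩ := hσ a (hfr ha) b (hfr hb) hab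
  exact ⟨σ, hσQ.trans hQD, hσK, hσc, haσ, hbσ, hσε⟩

/-- **The filled-trace identity under the extended inverse radial map.** Let
`ψ : 𝔻 → D = D₀(𝔻 ∖ P₁)` be a conformal equivalence with `ψ(0) = 0`, `ψ̄` its extension with
boundary values in `∂D`, and `P₂ ⊆ 𝔻̄` not containing `0`. Then
`ψ(D₀(𝔻 ∖ P₂)) = D₀(𝔻 ∖ (P₁ ∪ ψ̄(P₂)))`. [cite: MillerSheffield2013, Prop. 2.5 (proof)] -/
theorem _root_.Literature.Probability.RandomPlanarGeometry.ConformalEquiv.image_connectedComponentIn_eq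
    {D P₁ P₂ : Set ℂ} (ψ : ConformalEquiv (ball (0 : ℂ) 1) D) (hDo : IsOpen D)
    (hD : D = connectedComponentIn (ball (0 : ℂ) 1 \ P₁) 0) (hψ0 : ψ 0 = 0) {ψbar : ℂ → ℂ}
    (hext : ∀ x ∈ ball (0 : ℂ) 1, ψbar x = ψ x) (hbdry : ∀ x : ℂ, ‖x‖ = 1 → ψbar x ∈ frontier D)
    (hP₂ : P₂ ⊆ closedBall (0 : ℂ) 1) (h0P₂ : (0 : ℂ) ∉ P₂) :
    ψ '' connectedComponentIn (ball (0 : ℂ) 1 \ P₂) 0 =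
      connectedComponentIn (ball (0 : ℂ) 1 \ (P₁ ∪ ψbar '' P₂)) 0 := by
  set D₂ := connectedComponentIn (ball (0 : ℂ) 1 \ P₂) 0 with hD₂
  set O : Set ℂ := ball (0 : ℂ) 1 \ (P₁ ∪ ψbar '' P₂) with hO
  have hD₂ball : D₂ ⊆ ball (0 : ℂ) 1 := (connectedComponentIn_subset _ _).trans fun y hy ↦ hy.1
  have hDball : D ⊆ ball (0 : ℂ) 1 := by rw [hD]; exact (connectedComponentIn_subset _ _).trans fun y hy ↦ hy.1
  have hfrD : Disjoint (frontier D) D := by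
    rw [Set.disjoint_iff]
    rintro x ⟨hxf, hxD⟩
    have : x ∉ interior D := hxf.2
    rw [hDo.interior_eq] at this
    exact this hxD
  refine Subset.antisymm ?_ ?_
  · -- `ψ(D₂)` is connected, contains `0`, and lies in `O`
    have h0D₂ : (0 : ℂ) ∈ D₂ := mem_connectedComponentIn ⟨mem_ball_self one_pos, h0P₂⟩
    have hconn : IsPreconnected (ψ '' D₂) :=
      isPreconnected_connectedComponentIn.image _ (ψ.continuousOn.mono hD₂ball)
    refine hconn.subset_connectedComponentIn ⟨0, h0D₂, hψ0⟩ ?_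
    rintro _ ⟨p, hp, rfl⟩
    have hpball : p ∈ ball (0 : ℂ) 1 := hD₂ball hp
    have hψp : ψ p ∈ D := ψ.mapsTo hpball
    refine ⟨hDball hψp, ?_⟩
    rintro (h1 | ⟨q, hq, hqp⟩)
    · have hψp' : ψ p ∈ connectedComponentIn (ball (0 : ℂ) 1 \ P₁) 0 := by rw [← hD]; exact hψp
      exact (connectedComponentIn_subset _ _ hψp').2 h1
    · rcases (mem_closedBall_zero_iff.1 (hP₂ hq)).eq_or_lt with hq1 | hq1
      · exact Set.disjoint_left.1 hfrD (hqp ▸ hbdry q hq1) hψp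
      · have hqball : q ∈ ball (0 : ℂ) 1 := mem_ball_zero_iff.2 hq1
        rw [hext q hqball] at hqp
        have : q = p := ψ.injOn hqball hpball hqp
        exact (connectedComponentIn_subset _ _ hp).2 (this ▸ hq)
  · -- the component `W` of `0` in `O` lies in `D`, and `ψ⁻¹(W)` in `D₂`
    set W := connectedComponentIn O 0 with hW
    by_cases h0O : (0 : ℂ) ∈ O
    swap
    · rw [hW, connectedComponentIn_eq_empty h0O]; exact empty_subset _
    have hWD : W ⊆ D := by
      rw [hD]
      refine isPreconnected_connectedComponentIn.subset_connectedComponentIn (mem_connectedComponentIn h0O)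
        fun x hx ↦ ?_
      obtain ⟨hx1, hx2⟩ := connectedComponentIn_subset _ _ hx
      exact ⟨hx1, fun h ↦ hx2 (Or.inl h)⟩
    have hgW : IsPreconnected (ψ.symm '' W) :=
      isPreconnected_connectedComponentIn.image _ (ψ.symm.continuousOn.mono hWD)
    have hgWsub : ψ.symm '' W ⊆ ball (0 : ℂ) 1 \ P₂ := by
      rintro _ ⟨y, hy, rfl⟩
      have hyD : y ∈ D := hWD hy
      refine ⟨ψ.symm_mapsTo hyD, fun hq ↦ ?_⟩
      have h1 : ψbar (ψ.symm y) = y := by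
        rw [hext _ (ψ.symm_mapsTo hyD), ψ.apply_symm_apply hyD]
      exact (connectedComponentIn_subset _ _ hy).2 (Or.inr ⟨_, hq, h1⟩)
    have h0W : (0 : ℂ) ∈ W := mem_connectedComponentIn h0O
    have hg0 : ψ.symm 0 = 0 := by
      have := ψ.symm_apply_apply (mem_ball_self one_pos)
      rwa [hψ0] at this
    have hgWD₂ : ψ.symm '' W ⊆ D₂ := hgW.subset_connectedComponentIn ⟨0, h0W, hg0⟩ hgWsub
    intro y hy
    have hyD : y ∈ D := hWD hy
    exact ⟨ψ.symm y, hgWD₂ ⟨y, hy, rfl⟩, ψ.apply_symm_apply hyD⟩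

end InvEquiv

/-! ### Concatenation -/

/-- **Concatenation of radial pieces.** Generation data of the shifted-driver chain from the base
`b` up to `u` and from the base `b + u` up to `u'` give generation data from `b` up to `u + u'`:
the curve is `η₁` on `[0, u]` followed by `ψ̄ ∘ η₂ (· - u)`, `ψ̄` the Carathéodory extension of
`(g^𝔻_u)⁻¹` (the two charts differ by `g^𝔻_u`, `map_add_eq`; the junction `η₁(u) = ψ̄(η₂(0))`
is the tip at time `u`). Miller–Sheffield (2013), Prop. 2.2 (conformal Markov property) with
Pommerenke (1992), Thm. 2.1. [cite: MillerSheffield2013, Prop. 2.5 (proof)] -/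
theorem SDGenerated.append (hlam : Continuous lam) {b : ℝ} {u u' : ℝ≥0} {η₁ η₂ : ℝ≥0 → ℂ}
    (h₁ : SDGenerated lam b u η₁) (h₂ : SDGenerated lam (b + u) u' η₂) :
    ∃ η : ℝ≥0 → ℂ, SDGenerated lam b (u + u') η := by
  set U₁ := WholePlaneLoewner.shiftDriver lam b with hU₁
  set U₂ := WholePlaneLoewner.shiftDriver lam (b + u) with hU₂
  have hU₁c : Continuous U₁ := WholePlaneLoewner.continuous_shiftDriver hlam b
  set D := RadialLoewner.Disc.domain U₁ u with hDdef
  set P₁ : Set ℂ := η₁ '' Icc 0 u with hP₁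
  have hD : D = connectedComponentIn (ball (0 : ℂ) 1 \ P₁) 0 := h₁.domain_eq u le_rfl
  have hDo : IsOpen D := RadialLoewner.Disc.isOpen_domain hU₁c u
  have hDball : D ⊆ ball (0 : ℂ) 1 := RadialLoewner.Disc.domain_subset _ _
  have hDb : Bornology.IsBounded D := isBounded_ball.subset hDball
  set ψ := discInvEquiv hU₁c u with hψdef
  -- Carathéodory for `ψ : 𝔻 → D`
  have hP₁c : IsCompact P₁ := isCompact_Icc.image h₁.continuous
  have hP₁ulc : IsUniformlyLocallyConnected P₁ := by
    rw [hP₁, RadialFill.image_Icc_eq_image_real]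
    exact IsUniformlyLocallyConnected.of_image_Icc
      ((h₁.continuous.comp continuous_real_toNNReal).continuousOn)
  have hlc := hlc_connectedComponentIn hP₁c hP₁ulc
  rw [← hD] at hlc
  obtain ⟨hψc, hψext, hψlim⟩ := ConformalEquiv.continuousOn_extendFrom_of_lc ψ hDo hDb hlc
  set ψbar : ℂ → ℂ := extendFrom (ball (0 : ℂ) 1) ψ with hψbar
  have hbdry : ∀ x : ℂ, ‖x‖ = 1 → ψbar x ∈ frontier D := by
    intro x hx
    have hxcl : x ∈ closedBall (0 : ℂ) 1 := mem_closedBall_zero_iff.2 hx.le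
    haveI : NeBot (𝓝[ball (0 : ℂ) 1] x) := mem_closure_iff_nhdsWithin_neBot.1
      (by rw [closure_ball 0 one_ne_zero]; exact hxcl)
    exact ConformalEquiv.mem_frontier_of_tendsto ψ hDo (l := 𝓝[ball (0 : ℂ) 1] x) (g := id)
      self_mem_nhdsWithin hx (tendsto_nhdsWithin_of_tendsto_nhds tendsto_id) (hψlim x hxcl)
  have hψbar_mem : ∀ x ∈ closedBall (0 : ℂ) 1, ψbar x ∈ closedBall (0 : ℂ) 1 := by
    intro x hx
    haveI : NeBot (𝓝[ball (0 : ℂ) 1] x) := mem_closure_iff_nhdsWithin_neBot.1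
      (by rw [closure_ball 0 one_ne_zero]; exact hx)
    refine isClosed_closedBall.mem_of_tendsto (hψlim x hx) ?_
    filter_upwards [self_mem_nhdsWithin] with w hw using ball_subset_closedBall (hDball (ψ.mapsTo hw))
  have hψ0 : ψ 0 = 0 := by
    have h := ψ.apply_symm_apply (RadialLoewner.Disc.zero_mem_domain U₁ u)
    rwa [discInvEquiv_symm_apply, RadialLoewner.Disc.map_zero hU₁c u] at h
  -- the junction `η₁ u = ψ̄ (η₂ 0)`
  have hη₂0 : η₂ 0 = Complex.exp (((-lam (b + u) : ℝ) : ℂ) * Complex.I) := h₂.zero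
  have he1 : ‖η₂ 0‖ = 1 := by rw [hη₂0, Complex.norm_exp_ofReal_mul_I]
  have hjunction : η₁ u = ψbar (η₂ 0) := by
    have ht := h₁.tendsto u le_rfl
    have h2 : Tendsto (fun r : ℝ ↦ (r : ℂ) * η₂ 0) (𝓝[<] 1) (𝓝[ball (0 : ℂ) 1] (η₂ 0)) := by
      refine tendsto_nhdsWithin_iff.2 ⟨?_, ?_⟩
      · have : Tendsto (fun r : ℝ ↦ (r : ℂ) * η₂ 0) (𝓝 1) (𝓝 (((1 : ℝ) : ℂ) * η₂ 0)) :=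
          (Complex.continuous_ofReal.mul continuous_const).tendsto 1
        rw [Complex.ofReal_one, one_mul] at this
        exact this.mono_left nhdsWithin_le_nhds
      · filter_upwards [Ioo_mem_nhdsLT (show (0 : ℝ) < 1 by norm_num)] with r hr
        rw [mem_ball_zero_iff, norm_mul, Complex.norm_real, Real.norm_eq_abs, abs_of_pos hr.1, he1,
          mul_one]
        exact hr.2
    have h3 : Tendsto (fun r : ℝ ↦ ψ ((r : ℂ) * η₂ 0)) (𝓝[<] 1) (𝓝 (ψbar (η₂ 0))) :=
      (hψlim (η₂ 0) (mem_closedBall_zero_iff.2 he1.le)).comp h2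
    have h4 : Tendsto (fun r : ℝ ↦ ψ ((r : ℂ) * η₂ 0)) (𝓝[<] 1) (𝓝 (η₁ u)) := by
      refine ht.congr' (Eventually.of_forall fun r ↦ ?_)
      show invFunOn (RadialLoewner.Disc.map U₁ u) (RadialLoewner.Disc.domain U₁ u)
        ((r : ℂ) * Complex.exp (((U₁ u : ℝ) : ℂ) * Complex.I)) = ψ ((r : ℂ) * η₂ 0)
      rw [hη₂0]
      rfl
    exact tendsto_nhds_unique h4 h3
  -- the concatenated curve
  set η : ℝ≥0 → ℂ := fun v ↦ if v ≤ u then η₁ v else ψbar (η₂ (((v : ℝ) - u).toNNReal)) with hηdef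
  have hg2c : Continuous fun v : ℝ≥0 ↦ ψbar (η₂ (((v : ℝ) - u).toNNReal)) :=
    hψc.comp_continuous (h₂.continuous.comp (continuous_real_toNNReal.comp
      (NNReal.continuous_coe.sub continuous_const))) fun v ↦ mem_closedBall_zero_iff.2 (h₂.norm_le _)
  have hηc : Continuous η := by
    refine Continuous.if_le h₁.continuous hg2c continuous_id continuous_const fun v hv ↦ ?_
    rw [hv, sub_self, Real.toNNReal_zero]
    exact hjunction
  have hη_le : ∀ v, v ≤ u → η v = η₁ v := fun v hv ↦ if_pos hv
  have hη_add : ∀ s : ℝ≥0, η (u + s) = ψbar (η₂ s) := by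
    intro s
    rcases (s.2 : (0 : ℝ) ≤ s).eq_or_lt with h0 | h0
    · obtain rfl : s = 0 := NNReal.coe_eq_zero.1 h0.symm
      rw [add_zero, hη_le u le_rfl, hjunction]
    · have hs : 0 < s := NNReal.coe_pos.1 h0
      have hnot : ¬ (u + s ≤ u) := not_le.2 (lt_add_of_pos_right u hs)
      show (if u + s ≤ u then η₁ (u + s) else ψbar (η₂ ((((u + s : ℝ≥0) : ℝ) - u).toNNReal))) = ψbar (η₂ s)
      rw [if_neg hnot, NNReal.coe_add, add_sub_cancel_left, Real.toNNReal_coe]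
  have himage : ∀ s : ℝ≥0, η '' Icc 0 (u + s) = P₁ ∪ ψbar '' (η₂ '' Icc 0 s) := by
    intro s; ext x; constructor
    · rintro ⟨v, hv, rfl⟩
      by_cases hvu : v ≤ u
      · exact Or.inl ⟨v, ⟨hv.1, hvu⟩, (hη_le v hvu).symm⟩
      · obtain ⟨s', rfl⟩ := exists_add_of_le (not_le.1 hvu).le
        exact Or.inr ⟨η₂ s', ⟨s', ⟨zero_le, le_of_add_le_add_left hv.2⟩, rfl⟩, (hη_add s').symm⟩
    · rintro (⟨v, hv, rfl⟩ | ⟨_, ⟨s', hs', rfl⟩, rfl⟩)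
      · exact ⟨v, ⟨hv.1, hv.2.trans le_self_add⟩, hη_le v hv.2⟩
      · exact ⟨u + s', ⟨zero_le, add_le_add_right hs'.2 u⟩, hη_add s'⟩
  have h0P₂ : ∀ s : ℝ≥0, s ≤ u' → (0 : ℂ) ∉ η₂ '' Icc 0 s := by
    intro s hs h0
    have h := RadialLoewner.Disc.zero_mem_domain U₂ s
    rw [h₂.domain_eq s hs] at h
    exact (connectedComponentIn_subset _ _ h).2 h0
  refine ⟨η, ⟨hηc, ?_, ?_, ?_, ?_⟩⟩
  · rw [hη_le 0 (zero_le)]; exact h₁.zero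
  · intro v
    by_cases hv : v ≤ u
    · rw [hη_le v hv]; exact h₁.norm_le v
    · show ‖(if v ≤ u then η₁ v else ψbar (η₂ (((v : ℝ) - u).toNNReal)))‖ ≤ 1
      rw [if_neg hv]
      exact mem_closedBall_zero_iff.1 (hψbar_mem _ (mem_closedBall_zero_iff.2 (h₂.norm_le _)))
  · intro v hv
    by_cases hvu : v ≤ u
    · have : η '' Icc 0 v = η₁ '' Icc 0 v := image_congr fun w hw ↦ hη_le w (hw.2.trans hvu)
      rw [this]
      exact h₁.domain_eq v hvu
    · obtain ⟨s, rfl⟩ := exists_add_of_le (not_le.1 hvu).le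
      have hs : s ≤ u' := le_of_add_le_add_left hv
      rw [domain_add_eq_image hlam b u s, h₂.domain_eq s hs, himage s]
      exact ConformalEquiv.image_connectedComponentIn_eq ψ hDo hD hψ0 hψext hbdry
        (P₂ := η₂ '' Icc 0 s) (by rintro _ ⟨w, -, rfl⟩; exact mem_closedBall_zero_iff.2 (h₂.norm_le w))
        (h0P₂ s hs)
  · intro v hv
    by_cases hvu : v ≤ u
    · rw [hη_le v hvu]; exact h₁.tendsto v hvu
    · obtain ⟨s, rfl⟩ := exists_add_of_le (not_le.1 hvu).le
      have hs : s ≤ u' := le_of_add_le_add_left hv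
      rw [hη_add s]
      have ht := h₂.tendsto s hs
      have hU₂c : Continuous U₂ := WholePlaneLoewner.continuous_shiftDriver hlam (b + u)
      have hUeq : WholePlaneLoewner.shiftDriver lam b (u + s) = WholePlaneLoewner.shiftDriver lam (b + u) s := by
        simp only [WholePlaneLoewner.shiftDriver_apply, NNReal.coe_add, add_assoc]
      have hy : ∀ r ∈ Ioo (0 : ℝ) 1, (r : ℂ) * Complex.exp (((U₂ s : ℝ) : ℂ) * Complex.I) ∈ ball (0 : ℂ) 1 := by
        intro r hr
        rw [mem_ball_zero_iff, norm_mul, Complex.norm_exp_ofReal_mul_I, mul_one, Complex.norm_real,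
          Real.norm_eq_abs, abs_of_pos hr.1]
        exact hr.2
      have hin : Tendsto (fun r : ℝ ↦ invFunOn (RadialLoewner.Disc.map U₂ s) (RadialLoewner.Disc.domain U₂ s)
          ((r : ℂ) * Complex.exp (((U₂ s : ℝ) : ℂ) * Complex.I))) (𝓝[<] 1) (𝓝[ball (0 : ℂ) 1] (η₂ s)) := by
        refine tendsto_nhdsWithin_iff.2 ⟨ht, ?_⟩
        filter_upwards [Ioo_mem_nhdsLT (show (0 : ℝ) < 1 by norm_num)] with r hr
        exact RadialLoewner.Disc.domain_subset _ _
          (invFunOn_mem ((RadialLoewner.Disc.bijOn_map hU₂c s).surjOn (hy r hr)))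
      have hout := (hψlim (η₂ s) (mem_closedBall_zero_iff.2 (h₂.norm_le s))).comp hin
      refine hout.congr' ?_
      filter_upwards [Ioo_mem_nhdsLT (show (0 : ℝ) < 1 by norm_num)] with r hr
      rw [Function.comp_apply, hUeq, invFunOn_map_add hlam b u s (hy r hr)]
      rfl


/-! ### From windows to every horizon -/

/-- A uniform positive lower bound of the horizons over rational bases in `[q - 1, q + N]`, from
lower bounds on the unit windows `[t - 1, t]`. [folklore] -/
theorem exists_uniform_horizon {h : ℚ → ℝ≥0}
    (hunif : ∀ t : ℝ, ∃ h₀ : ℝ≥0, 0 < h₀ ∧ ∀ q : ℚ, (q : ℝ) ∈ Icc (t - 1) t → h₀ ≤ h q)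
    (q₀ : ℚ) (N : ℕ) :
    ∃ hs : ℝ≥0, 0 < hs ∧ ∀ q : ℚ, (q : ℝ) ∈ Icc ((q₀ : ℝ) - 1) (q₀ + N) → hs ≤ h q := by
  induction N with
  | zero =>
    obtain ⟨h₀, hh₀, hb⟩ := hunif q₀
    exact ⟨h₀, hh₀, fun q hq ↦ hb q (by simpa using hq)⟩
  | succ N ih =>
    obtain ⟨hs, hhs, hb⟩ := ih
    obtain ⟨h₀, hh₀, hb'⟩ := hunif ((q₀ : ℝ) + (N + 1))
    refine ⟨min hs h₀, lt_min hhs hh₀, fun q hq ↦ ?_⟩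
    rcases le_or_gt (q : ℝ) (q₀ + N) with hle | hgt
    · exact (min_le_left _ _).trans (hb q ⟨hq.1, hle⟩)
    · refine (min_le_right _ _).trans (hb' q ⟨by linarith, ?_⟩)
      have := hq.2; push_cast at this ⊢; linarith

/-- **From windows to every horizon.** If from every rational base time `q` the increment driver
is locally generated up to a horizon `h q`, and the horizons are bounded below uniformly for bases
in every unit window (`WholePlaneLoewnerChain.exists_pathHorizon_ge`), then from every rational base
the increments are locally generated up to every time (successive concatenation,
`SDGenerated.append`, with rational junction bases). [cite: MillerSheffield2013, Prop. 2.5 (proof)] -/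
theorem locallyGenerated_of_windows (hlam : Continuous lam) {h : ℚ → ℝ≥0}
    (hwin : ∀ q : ℚ, RadialSLE.LocallyGenerated (incr lam q) (h q))
    (hunif : ∀ t : ℝ, ∃ h₀ : ℝ≥0, 0 < h₀ ∧ ∀ q : ℚ, (q : ℝ) ∈ Icc (t - 1) t → h₀ ≤ h q)
    (q₀ : ℚ) (u₁ : ℝ) : RadialSLE.LocallyGenerated (incr lam q₀) u₁ := by
  refine locallyGenerated_of_sdGenerated hlam (fun M ↦ ?_) u₁
  -- a uniform step on `[q₀ - 1, q₀ + N]`, `N = ⌈M⌉₊ + 2`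
  set N : ℕ := ⌈(M : ℝ)⌉₊ + 2 with hN
  obtain ⟨hs, hhs, hstep⟩ := exists_uniform_horizon hunif q₀ N
  have hhs' : (0 : ℝ) < hs := by exact_mod_cast hhs
  have hMN : (M : ℝ) + 1 ≤ N := by
    rw [hN]; push_cast; linarith [Nat.le_ceil (M : ℝ)]
  -- pieces from rational bases `q ∈ [q₀, q₀ + N]`, of length `hs / 2`
  have hpiece : ∀ q : ℚ, (q : ℝ) ∈ Icc (q₀ : ℝ) (q₀ + N) →
      ∃ η : ℝ≥0 → ℂ, SDGenerated lam q (hs / 2) η := by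
    intro q hq
    refine SDGenerated.of_locallyGenerated hlam (hwin q) ?_
    have h1 := hstep q ⟨by linarith [hq.1], hq.2⟩
    have h2 : ((hs / 2 : ℝ≥0) : ℝ) < hs := by push_cast; linarith
    exact h2.trans_le (by exact_mod_cast h1)
  -- induction on the number of steps
  have hind : ∀ n : ℕ, ∃ v : ℝ≥0, (∃ η : ℝ≥0 → ℂ, SDGenerated lam q₀ v η) ∧
      ((n : ℝ) * (hs / 4) ≤ v ∨ (M : ℝ) + 1 ≤ v) := by
    intro n
    induction n with
    | zero =>
      obtain ⟨η, hη⟩ := hpiece q₀ ⟨le_rfl, by linarith⟩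
      exact ⟨0, ⟨η, hη.mono zero_le⟩, Or.inl (by simp)⟩
    | succ n ih =>
      obtain ⟨v, ⟨η, hη⟩, halt⟩ := ih
      by_cases hdone : (M : ℝ) + 1 ≤ v
      · exact ⟨v, ⟨η, hη⟩, Or.inr hdone⟩
      have hv : (n : ℝ) * (hs / 4) ≤ v := halt.resolve_right hdone
      have hvlt : (v : ℝ) < M + 1 := not_le.1 hdone
      -- the junction base `q`, rational, with `u = q - q₀ ∈ (v - hs/4, v]`
      obtain ⟨q, u, hqu, huv, hulow⟩ : ∃ (q : ℚ) (u : ℝ≥0), (q : ℝ) = q₀ + u ∧ u ≤ v ∧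
          (v : ℝ) - hs / 4 < u := by
        by_cases hsmall : (v : ℝ) < hs / 4
        · exact ⟨q₀, 0, by simp, zero_le, by push_cast; linarith⟩
        · obtain ⟨q, hq1, hq2⟩ := exists_rat_btwn (show (q₀ : ℝ) + v - hs / 4 < q₀ + v by linarith)
          have hqpos : (0 : ℝ) ≤ q - q₀ := by linarith [not_lt.1 hsmall]
          refine ⟨q, ((q : ℝ) - q₀).toNNReal, ?_, ?_, ?_⟩
          · rw [Real.coe_toNNReal _ hqpos]; ring
          · rw [← NNReal.coe_le_coe, Real.coe_toNNReal _ hqpos]; linarith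
          · rw [Real.coe_toNNReal _ hqpos]; linarith
      have hqrange : (q : ℝ) ∈ Icc (q₀ : ℝ) (q₀ + N) := by
        rw [hqu]
        exact ⟨by linarith [u.coe_nonneg], by
          have := NNReal.coe_le_coe.2 huv; linarith⟩
      obtain ⟨η₂, hη₂⟩ := hpiece q hqrange
      rw [hqu] at hη₂
      obtain ⟨η', hη'⟩ := (hη.mono huv).append hlam hη₂
      refine ⟨u + hs / 2, ⟨η', hη'⟩, Or.inl ?_⟩
      push_cast
      nlinarith [hv, hulow, hhs']
  -- conclusion: enough steps
  obtain ⟨n, hn⟩ := exists_nat_ge (((M : ℝ) + 1) / (hs / 4))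
  obtain ⟨v, ⟨η, hη⟩, halt⟩ := hind n
  have hvM : M ≤ v := by
    rw [← NNReal.coe_le_coe]
    rcases halt with h1 | h1
    · have : ((M : ℝ) + 1) ≤ (n : ℝ) * (hs / 4) := by
        rw [div_le_iff₀ (by positivity)] at hn; linarith
      linarith
    · linarith
  exact ⟨η, hη.mono hvM⟩

end WholePlaneLoewnerChain

end Literature.Probability.RandomPlanarGeometry
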